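import Mathlib
import HarnessLib
import HarnessLib.Audit
import Literature.Analysis.FunctionSpaces.BesselJZeroSqrtLaplace
import Summits.ValiantsHypothesis.ValiantsHypothesis.Theorems.LacunarySymmetroidMatrixDescartesToyALawDefs
import Summits.ValiantsHypothesis.ValiantsHypothesis.Theorems.LacunarySymmetroidMatrixDescartesToyALawSignChanges
import Summits.ValiantsHypothesis.ValiantsHypothesis.Theorems.LacunarySymmetroidMatrixDescartesToyALawExpPoly
import Summits.ValiantsHypothesis.ValiantsHypothesis.Theorems.LacunarySymmetroidMatrixDescartesToyALawMultiplier
import Summits.ValiantsHypothesis.ValiantsHypothesis.Theorems.LacunarySymmetroidMatrixDescartesToyALawLaplace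

/-!
# ValiantsHypothesis / LacunarySymmetroid — crux `MatrixDescartes` (stmt-ValiantsHypothesis-18050, V1), LINE (A) «product_plus_one»:
# binomial-limit TOY THEOREM, module 6 — `toyALaw`

**THE TOY THEOREM** (pen val-idea-25 g8 NOTE §54.13, refereed PASS ×2 with page-verified citations: val-idea-crit-6 g11 #83,
val-idea-crit-1 g10 #381): for `t_f > 0` and real `λ_f, τ`, the toy A-function `A_toy(Y) = Σ_f λ_f t_f²(Y − τt_f)/(Y + t_f)³`
has at most `2r − 1` zeros on `(0, ∞)` counted with multiplicity, i.e. its numerator `toyNum` has at most `2r − 1` positive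
roots counted with multiplicity (`toyALaw`).  Proof as in the NOTE: `A_toy = ∫₀^∞ e^{−Yθ} φ(θ) dθ` with
`φ(θ) = θ·Σ_f e^{−t_fθ}(λ_f t_f² − (1+τ)λ_f t_f³ θ/2)`; merging equal `t_f`, `φ/θ` is an exponential polynomial with `|S| ≤ r`
exponents and degree-`≤ 1` coefficients, so `V(φ) ≤ 2|S| − 1` (module 2 = Pólya–Szegő V.75); a multiplier of `≤ 2|S| − 1` points
makes it one-signed (module 4); Laguerre's transfer (module 5 = Pólya–Szegő V.80) bounds the positive roots of `toyNum`.
Also the pen's Sketch form (`toyALaw_ncard`: the positive zero set of `Atoy` is finite of size `≤ 2r − 1`, for `r, τ, λ_f > 0`).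
NEAREST TREE FACT (cited, not imported): `Literature/Analysis/TotalPositivity/LaguerreLaplaceRuleOfSigns.lean` (Pólya–Szegő
V.77/V.80 in the analytic currency `ZerosWithMultiplicityLE`); modules 4/5 redo V.80 for polynomial numerators, module 2 (V.75,
polynomial coefficients) is not in that file.

HONEST FRAMING: a free-standing kernel theorem about the `η → 0` TOY of LINE (A)'s A-function (NOTE 54.12: «not about the
crux's objects except in a limit»); no stub of LINE (A) is touched (A40 custody unchanged, sorries 4 → 4); `MatrixDescartes`
OPEN; `VP ≠ VNP` is NOT proved and nothing here bears on it.
-/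

set_option linter.dupNamespace false

namespace Summit.ValiantsHypothesis.ValiantsHypothesis.Theorems.LacunarySymmetroidMatrixDescartes

namespace ToyALaw

open Polynomial Finset MeasureTheory Filter
open Literature.Analysis.FunctionSpaces (integral_pow_mul_exp_neg_mul_Ioi integrableOn_pow_mul_exp_neg_mul_Ioi)

variable {r : ℕ} (t lam : Fin r → ℝ) (τ : ℝ)

/-! ## The Laplace density of `A_toy` -/

/-- **Laplace representation**: for `t_f > 0` and `Y > 0`,
`∫₀^∞ e^{−Yθ} Σ_f (λ_f t_f²·θe^{−t_fθ} − (1+τ)λ_f t_f³/2·θ²e^{−t_fθ}) dθ = A_toy(Y)`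
(Euler: `∫₀^∞ θ e^{−pθ} = 1/p²`, `∫₀^∞ θ² e^{−pθ} = 2/p³`, `p = Y + t_f`). -/
theorem integral_toyDensity (ht : ∀ f, 0 < t f) {Y : ℝ} (hY : 0 < Y) :
    ∫ θ in Set.Ioi 0, Real.exp (-(Y * θ)) *
        ∑ f, (lam f * t f ^ 2 * (θ ^ 1 * Real.exp (-(t f * θ))) +
          -((1 + τ) * lam f * t f ^ 3 / 2) * (θ ^ 2 * Real.exp (-(t f * θ)))) = toyA t lam τ Y := by
  have hp : ∀ f, 0 < Y + t f := fun f => by linarith [ht f]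
  have hexp : ∀ f (θ : ℝ) (k : ℕ), Real.exp (-(Y * θ)) * (θ ^ k * Real.exp (-(t f * θ))) =
      θ ^ k * Real.exp (-((Y + t f) * θ)) := by
    intro f θ k
    rw [show -((Y + t f) * θ) = -(Y * θ) + -(t f * θ) by ring, Real.exp_add]; ring
  have hpt : ∀ θ : ℝ, Real.exp (-(Y * θ)) *
      ∑ f, (lam f * t f ^ 2 * (θ ^ 1 * Real.exp (-(t f * θ))) +
        -((1 + τ) * lam f * t f ^ 3 / 2) * (θ ^ 2 * Real.exp (-(t f * θ)))) =
      ∑ f, (lam f * t f ^ 2 * (θ ^ 1 * Real.exp (-((Y + t f) * θ))) +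
        -((1 + τ) * lam f * t f ^ 3 / 2) * (θ ^ 2 * Real.exp (-((Y + t f) * θ)))) := by
    intro θ
    rw [mul_sum]
    refine sum_congr rfl fun f _ => ?_
    rw [← hexp f θ 1, ← hexp f θ 2]; ring
  rw [integral_congr_ae (Eventually.of_forall hpt)]
  have hint : ∀ f (k : ℕ) (a : ℝ), IntegrableOn (fun θ : ℝ => a * (θ ^ k * Real.exp (-((Y + t f) * θ)))) (Set.Ioi 0) :=
    fun f k a => (integrableOn_pow_mul_exp_neg_mul_Ioi (hp f) k).const_mul a
  have hint2 : ∀ f, Integrable (fun θ : ℝ => lam f * t f ^ 2 * (θ ^ 1 * Real.exp (-((Y + t f) * θ))) +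
      -((1 + τ) * lam f * t f ^ 3 / 2) * (θ ^ 2 * Real.exp (-((Y + t f) * θ)))) (volume.restrict (Set.Ioi 0)) := by
    intro f
    have h := (hint f 1 (lam f * t f ^ 2)).add (hint f 2 (-((1 + τ) * lam f * t f ^ 3 / 2)))
    exact h
  rw [integral_finsetSum univ
    (f := fun i θ => lam i * t i ^ 2 * (θ ^ 1 * Real.exp (-((Y + t i) * θ))) +
      -((1 + τ) * lam i * t i ^ 3 / 2) * (θ ^ 2 * Real.exp (-((Y + t i) * θ))))
    (fun f _ => hint2 f)]
  unfold toyA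
  refine sum_congr rfl fun f _ => ?_
  rw [integral_add (hint f 1 (lam f * t f ^ 2)) (hint f 2 (-((1 + τ) * lam f * t f ^ 3 / 2))),
    integral_const_mul, integral_const_mul,
    integral_pow_mul_exp_neg_mul_Ioi (hp f) 1, integral_pow_mul_exp_neg_mul_Ioi (hp f) 2]
  have hp' : (Y + t f) ≠ 0 := (hp f).ne'
  simp only [Nat.factorial, Nat.succ_eq_add_one, Nat.cast_one, mul_one, zero_add]
  field_simp
  ring

/-- The density is dominated by a polynomial on `(0, ∞)` (all `t_f > 0`, so `e^{−t_fθ} ≤ 1`). -/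
theorem abs_toyDensity_le (ht : ∀ f, 0 < t f) (θ : ℝ) (hθ : 0 < θ) :
    |∑ f, (lam f * t f ^ 2 * (θ ^ 1 * Real.exp (-(t f * θ))) +
        -((1 + τ) * lam f * t f ^ 3 / 2) * (θ ^ 2 * Real.exp (-(t f * θ))))| ≤
      (∑ f, (C |lam f * t f ^ 2| * X + C |(1 + τ) * lam f * t f ^ 3 / 2| * X ^ 2)).eval θ := by
  rw [eval_finsetSum]
  refine (abs_sum_le_sum_abs _ _).trans (sum_le_sum fun f _ => ?_)
  simp only [eval_add, eval_mul, eval_C, eval_X, eval_pow, pow_one]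
  have he : Real.exp (-(t f * θ)) ≤ 1 := Real.exp_le_one_iff.2 (by nlinarith [ht f])
  have he0 : 0 < Real.exp (-(t f * θ)) := Real.exp_pos _
  refine (abs_add_le _ _).trans (add_le_add ?_ ?_)
  · rw [abs_mul (lam f * t f ^ 2), abs_mul θ, abs_of_pos hθ, abs_of_pos he0]
    calc |lam f * t f ^ 2| * (θ * Real.exp (-(t f * θ))) ≤ |lam f * t f ^ 2| * (θ * 1) := by gcongr
      _ = |lam f * t f ^ 2| * θ := by ring
  · rw [abs_mul (-((1 + τ) * lam f * t f ^ 3 / 2)), abs_neg, abs_mul (θ ^ 2), abs_of_pos (pow_pos hθ 2),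
      abs_of_pos he0]
    calc |(1 + τ) * lam f * t f ^ 3 / 2| * (θ ^ 2 * Real.exp (-(t f * θ)))
        ≤ |(1 + τ) * lam f * t f ^ 3 / 2| * (θ ^ 2 * 1) := by gcongr
      _ = |(1 + τ) * lam f * t f ^ 3 / 2| * θ ^ 2 := by ring

/-- **Sign changes of the density**: merging the rows with equal `t_f` over `S = {−t_f}`, `φ(θ) = θ·h(θ)` with `h` an
exponential polynomial with `|S| ≤ r` exponents and coefficients of degree `≤ 1`; hence (module 2) `V_{(0,∞)}(φ) ≤ 2|S| − 1`. -/
theorem signChangesLE_toyDensity :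
    SignChangesLE (fun θ => ∑ f, (lam f * t f ^ 2 * (θ ^ 1 * Real.exp (-(t f * θ))) +
        -((1 + τ) * lam f * t f ^ 3 / 2) * (θ ^ 2 * Real.exp (-(t f * θ)))))
      (Set.Ioi 0) (2 * ((Finset.univ.image (fun f => -t f)).card) - 1) := by
  classical
  set a : Fin r → ℝ := fun f => lam f * t f ^ 2 with ha
  set b : Fin r → ℝ := fun f => -((1 + τ) * lam f * t f ^ 3 / 2) with hb
  set S : Finset ℝ := Finset.univ.image (fun f => -t f) with hS
  set α : ℝ → ℝ := fun s => ∑ f ∈ univ.filter (fun f => -t f = s), a f with hα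
  set β : ℝ → ℝ := fun s => ∑ f ∈ univ.filter (fun f => -t f = s), b f with hβ
  set P : ℝ → ℝ[X] := fun s => C (β s) * X + C (α s) with hP
  -- the merged exponential polynomial equals the row sum
  have key : ∀ θ : ℝ, expPoly S P θ = ∑ f, Real.exp (-(t f * θ)) * (a f + b f * θ) := by
    intro θ
    rw [expPoly, ← sum_fiberwise_of_maps_to (s := univ) (t := S) (g := fun f => -t f)
      (fun f _ => mem_image_of_mem _ (mem_univ f))]
    refine sum_congr rfl fun s _ => ?_
    simp only [hP, eval_add, eval_mul, eval_C, eval_X, hα, hβ]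
    rw [sum_mul, ← sum_add_distrib, mul_sum]
    refine sum_congr rfl fun f hf => ?_
    rw [(mem_filter.1 hf).2.symm]
    ring_nf
  have hfun : ∀ θ ∈ Set.Ioi (0 : ℝ), (fun θ => θ * expPoly S P θ) θ =
      ∑ f, (lam f * t f ^ 2 * (θ ^ 1 * Real.exp (-(t f * θ))) +
        -((1 + τ) * lam f * t f ^ 3 / 2) * (θ ^ 2 * Real.exp (-(t f * θ)))) := by
    intro θ _
    show θ * expPoly S P θ = _
    rw [key θ, mul_sum]
    refine sum_congr rfl fun f _ => ?_
    simp only [ha, hb]; ring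
  by_cases hex : ∃ s ∈ S, P s ≠ 0
  · have hE := signChangesLE_expPoly S P hex
    have hdeg : ∑ s ∈ S, ((P s).natDegree + 1) - 1 ≤ 2 * S.card - 1 := by
      have : ∑ s ∈ S, ((P s).natDegree + 1) ≤ ∑ s ∈ S, 2 :=
        sum_le_sum fun s _ => by have := natDegree_linear_le (a := β s) (b := α s); simp only [hP]; omega
      rw [sum_const, smul_eq_mul] at this
      omega
    have h1 : SignChangesLE (expPoly S P) (Set.Ioi 0) (2 * S.card - 1) := (hE.mono hdeg).anti (Set.subset_univ _)
    exact (h1.mul_pos (w := fun θ => θ) fun θ hθ => hθ).congr hfun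
  · push Not at hex
    have h0 : ∀ θ ∈ Set.Ioi (0 : ℝ), expPoly S P θ = 0 := by
      intro θ _
      rw [expPoly]
      exact sum_eq_zero fun s hs => by rw [hex s hs]; simp
    have h1 : SignChangesLE (fun θ => θ * expPoly S P θ) (Set.Ioi 0) 0 :=
      signChangesLE_of_nonneg fun θ hθ => by rw [h0 θ hθ, mul_zero]
    exact ((h1.mono (Nat.zero_le _)).congr hfun)

/-! ## The toy theorem -/

/-- **TOY THEOREM (binomial-limit A-LAW with the sharp constant; pen NOTE §54.13, kernel version).**  For `t_f > 0` and
arbitrary real `λ_f, τ`, the numerator `toyNum` of `A_toy(Y) = Σ_f λ_f t_f²(Y − τt_f)/(Y + t_f)³` has at most `2r − 1` positive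
roots counted with multiplicity; i.e. `A_toy` has at most `2r − 1` zeros on `(0,∞)` counted with multiplicity (`toyA_eq_div`,
`toyDen > 0` there).  (Vacuous when `toyNum = 0`, e.g. `r = 0`; for `λ_f > 0` one has `toyNum ≠ 0`, cf. `toyALaw_ncard`.) -/
theorem toyALaw (ht : ∀ f, 0 < t f) :
    Multiset.card ((toyNum t lam τ).roots.filter (fun Y => 0 < Y)) ≤ 2 * r - 1 := by
  classical
  set g : ℝ → ℝ := fun θ => ∑ f, (lam f * t f ^ 2 * (θ ^ 1 * Real.exp (-(t f * θ))) +
    -((1 + τ) * lam f * t f ^ 3 / 2) * (θ ^ 2 * Real.exp (-(t f * θ)))) with hg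
  have hgc : ContinuousOn g (Set.Ioi 0) := (by rw [hg]; fun_prop : Continuous g).continuousOn
  have hB := abs_toyDensity_le t lam τ ht
  have hSC := signChangesLE_toyDensity t lam τ
  obtain ⟨V, hV, c, -, hsign⟩ :=
    exists_multiplier_of_signChangesLE (I := Set.Ioi 0) Set.ordConnected_Ioi hgc hSC
  have hD : ∀ Y : ℝ, 0 < Y → (toyDen t).eval Y ≠ 0 := fun Y hY =>
    toyDen_eval_ne_zero t fun f => by linarith [ht f]
  have hL : ∀ Y : ℝ, 0 < Y → (toyNum t lam τ).eval Y / (toyDen t).eval Y =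
      ∫ θ in Set.Ioi 0, Real.exp (-(Y * θ)) * g θ := fun Y hY => by
    rw [← toyA_eq_div t lam τ (fun f => by linarith [ht f]), hg, integral_toyDensity t lam τ ht hY]
  have hmain := card_posRoots_le_of_laplace_multiplier V g _ (toyNum t lam τ) (toyDen t) c hgc hB hD hL hsign
  have hS : (Finset.univ.image (fun f : Fin r => -t f)).card ≤ r :=
    card_image_le.trans (by rw [Finset.card_univ, Fintype.card_fin])
  omega

/-- For `λ_f > 0`, `τ > 0` and `r > 0` the numerator is not the zero polynomial (`A_toy(Y) > 0` for `Y > τ·Σ t_f`). -/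
theorem toyNum_ne_zero (hr : 0 < r) (hτ : 0 < τ) (ht : ∀ f, 0 < t f) (hlam : ∀ f, 0 < lam f) :
    toyNum t lam τ ≠ 0 := by
  set Y : ℝ := τ * ∑ f, t f + 1 with hY
  have hYt : ∀ f, 0 < Y - τ * t f := by
    intro f
    have : t f ≤ ∑ f, t f := single_le_sum (f := t) (fun f _ => (ht f).le) (mem_univ f)
    rw [hY]; nlinarith
  have hYpos : 0 < Y := by
    rw [hY]; have := sum_nonneg (s := Finset.univ) fun f (_ : f ∈ Finset.univ) => (ht f).le; positivity
  have hA : 0 < toyA t lam τ Y := by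
    unfold toyA
    haveI : Nonempty (Fin r) := ⟨⟨0, hr⟩⟩
    refine sum_pos (fun f _ => ?_) univ_nonempty
    have h1 : 0 < Y + t f := by linarith [ht f]
    exact div_pos (mul_pos (mul_pos (hlam f) (pow_pos (ht f) 2)) (hYt f)) (pow_pos h1 3)
  intro h0
  rw [toyA_eq_div t lam τ (fun f => by linarith [ht f]), h0, eval_zero, zero_div] at hA
  exact lt_irrefl _ hA

/-- **The pen's Sketch form** (crux idea card `strip-identity-binomial-vd`, `ToyALaw` with `Atoy`): for `r, τ, λ_f, t_f > 0`
the set of positive zeros of `A_toy` is finite and has at most `2r − 1` elements (distinct zeros; the multiplicity form is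
`toyALaw`). -/
theorem toyALaw_ncard : ∀ (r : ℕ) (t lam : Fin r → ℝ) (τ : ℝ), 0 < r → 0 < τ → (∀ f, 0 < t f) → (∀ f, 0 < lam f) →
    ({Y : ℝ | 0 < Y ∧ Atoy r t lam τ Y = 0}.Finite ∧
      {Y : ℝ | 0 < Y ∧ Atoy r t lam τ Y = 0}.ncard ≤ 2 * r - 1) := by
  intro r t lam τ hr hτ ht hlam
  classical
  have hN := toyNum_ne_zero t lam τ hr hτ ht hlam
  set F : Finset ℝ := ((toyNum t lam τ).roots.filter (fun Y => 0 < Y)).toFinset with hF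
  have hsub : {Y : ℝ | 0 < Y ∧ Atoy r t lam τ Y = 0} ⊆ ↑F := by
    rintro Y ⟨hY, hA⟩
    rw [Atoy_eq_toyA, toyA_eq_div t lam τ (fun f => by linarith [ht f]), div_eq_zero_iff] at hA
    have hnum : (toyNum t lam τ).eval Y = 0 :=
      hA.resolve_right (toyDen_eval_ne_zero t fun f => by linarith [ht f])
    rw [hF, Finset.mem_coe, Multiset.mem_toFinset, Multiset.mem_filter, mem_roots hN]
    exact ⟨hnum, hY⟩
  have hfin : {Y : ℝ | 0 < Y ∧ Atoy r t lam τ Y = 0}.Finite := (F.finite_toSet).subset hsub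
  refine ⟨hfin, ?_⟩
  calc {Y : ℝ | 0 < Y ∧ Atoy r t lam τ Y = 0}.ncard ≤ (↑F : Set ℝ).ncard := Set.ncard_le_ncard hsub F.finite_toSet
    _ = F.card := Set.ncard_coe_finset F
    _ ≤ Multiset.card ((toyNum t lam τ).roots.filter (fun Y => 0 < Y)) := Multiset.toFinset_card_le _
    _ ≤ 2 * r - 1 := toyALaw t lam τ ht

end ToyALaw

end Summit.ValiantsHypothesis.ValiantsHypothesis.Theorems.LacunarySymmetroidMatrixDescartes
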